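import Mathlib
import HarnessLib
import Summits.Langlands.Langlands.Theses.OrdinaryPrimeTransport
import Literature.NumberTheory.GaloisRepresentations.DecomposedGeneric
import Literature.NumberTheory.EllipticCurves.SupersingularDensity

/-!
# Crux-strategist census file for crux #3 `OrdinaryPrimeExists` (stmt-Langlands-17211)

Scratch evidence for `STRATEGY-CENSUS.md` (unit `cstrat-stmt-Langlands-17211-b1`, planner,
crux-strategist, gen 1, 2026-08-17).  Nothing here is route structure; it only TYPES the census
entries over existing declarations, so that every signature quoted in the census elaborates.

Crux (FIXED, never restated or weakened):
`Summit.Langlands.Langlands.Theses.OrdinaryPrimeTransport.OrdinaryPrimeExists` — for `K` totally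
real or CM, `p ≥ 3` prime, `π` cuspidal on `GL_p(𝔸_K)`, L-algebraic with a regular infinity type,
there are a prime `ℓ₀`, `ι₀ : ℚ̄_{ℓ₀} ≃ ℂ` and an a.e.-Satake–Frobenius-compatible avatar `ρ₁`
which is `IsCrystallineOrdinaryAt ℓ₀ v` (Greenberg-ordinary full flag, graded pieces
`unramified · ε^{b_i}`, `b` strictly decreasing; semistable, NOT required crystalline — module
docstring of `CrystallineOrdinary.lean`) at EVERY `v ∣ ℓ₀`.

Contents:
* §0 `HasOrdinaryAvatarAt`, `InSector`, `ordinaryPrimeExists_iff` — the crux's matrix, named, and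
  the crux regrouped over it (proved, `Iff` by unfolding only).
* §1 STRENGTHEN — `SPlusCofiniteSplit` (all but finitely many totally split primes are ordinary
  primes: FALSE for automorphically induced `π`, see the census), `SPlusLowerDensity` (the
  positive-density form = Serre's ordinariness conjecture for these `π`), and the trivial glue
  `ordinaryPrimeExists_of_sPlusCofiniteSplit` (modulo infinitude of totally split primes).
* §2 TRANSFER — the first lemma of the only technique with teeth on any sibling (Serre 1981 /
  Ogus / Suh 2020 Prop. 36 / Wang–Zhang 2026 Thm 1.7: archimedean PINNING of a non-ordinary
  Hecke eigenvalue into `ℓ^m · (finite set)`, then Chebotarev in an auxiliary `λ'`-adic image):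
  `pinning` and `pinningSet_finite` (both PROVED), and the NUMEROLOGY that decides where the
  pinning hypothesis can hold (`numerology_pass_two_three`, `numerology_fail`): only rank `≤ 3`
  with CONSECUTIVE Hodge–Tate weights.  The surviving corner of the crux is typed as
  `CornerGL3Q` (documented as a paper-level theorem conditional on Ramanujan; NOT a line).
* §3 NEGATION — `SerreOrdinarinessGL2Q`, the classical open problem ("every regular algebraic
  cuspidal `π` on `GL_2(𝔸_ℚ)` has one ordinary prime", i.e. every newform of weight `k ≥ 2` is
  `λ`-ordinary for SOME `λ`), which the `K = ℚ`, `p = 3` slice of the crux CONTAINS through the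
  Gelbart–Jacquet lift `Sym²` (census §Negation; the containment is argued on paper, not typed).
-/

set_option linter.dupNamespace false
set_option linter.unusedVariables false

noncomputable section

namespace Summit.Langlands.Langlands.Cruxes.OrdinaryPrimeExists.Strategist

open Summit.Langlands.Langlands.Theses.OrdinaryPrimeTransport
open Filter IsDedekindDomain
open Literature.NumberTheory.Automorphic Literature.NumberTheory.GaloisRepresentations
open scoped NumberField Classical

/-! ## §0  The crux's matrix, named -/

/-- **`π` has an ordinary `ℓ₀`-adic avatar for `ι₀`**: the matrix of the crux — some framed
`ρ₁ : Γ_K → GL_p(ℚ̄_{ℓ₀})`, Satake–Frobenius compatible with `(π, ι₀)` at all but finitely many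
places, is `IsCrystallineOrdinaryAt ℓ₀ v` at every `v ∣ ℓ₀`. [folklore] -/
def HasOrdinaryAvatarAt {K : Type} [Field K] [NumberField K] {p : ℕ}
    {hcpt : isCompact_glFiniteIntegralLevel p K} (π : CuspidalAutomorphicRepData p K hcpt)
    (ℓ₀ : ℕ) [Fact ℓ₀.Prime] (ι₀ : PadicAlgCl ℓ₀ ≃+* ℂ) : Prop :=
  ∃ ρ₁ : FramedGaloisRep K (PadicAlgCl ℓ₀) p,
    (∀ᶠ v : HeightOneSpectrum (𝓞 K) in cofinite,
        Summit.Langlands.SatakeFrobCompatibleAt ι₀ π.1 ρ₁ v) ∧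
      ∀ v : HeightOneSpectrum (𝓞 K), ((ℓ₀ : ℕ) : 𝓞 K) ∈ v.asIdeal → ρ₁.IsCrystallineOrdinaryAt ℓ₀ v

/-- **The crux's hypotheses, bundled**: `K` totally real or CM, `p ≥ 3` prime, `π` L-algebraic with
a regular infinity type. [folklore] -/
def InSector (K : Type) [Field K] [NumberField K] (p : ℕ)
    {hcpt : isCompact_glFiniteIntegralLevel p K} (π : CuspidalAutomorphicRepData p K hcpt) : Prop :=
  (NumberField.IsTotallyReal K ∨ NumberField.IsCMField K) ∧ Nat.Prime p ∧ 3 ≤ p ∧ π.1.IsLAlgebraic ∧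
    ∃ T : InfinityType K p, π.1.HasInfinityType T ∧ T.IsRegular

/-- **The crux regrouped** over `InSector` / `HasOrdinaryAvatarAt` (unfolding only; the crux is
not restated, this is literally it). [folklore] -/
theorem ordinaryPrimeExists_iff :
    OrdinaryPrimeExists ↔
      ∀ (K : Type) [Field K] [NumberField K] (p : ℕ) (hcpt : isCompact_glFiniteIntegralLevel p K)
        (π : CuspidalAutomorphicRepData p K hcpt), InSector K p π →
        ∃ (ℓ₀ : ℕ) (_ : Fact ℓ₀.Prime) (ι₀ : PadicAlgCl ℓ₀ ≃+* ℂ), HasOrdinaryAvatarAt π ℓ₀ ι₀ := by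
  constructor
  · rintro h K _ _ p hcpt π ⟨hK, hp, h3, hL, hreg⟩
    exact h K hK p hp h3 hcpt π hL hreg
  · intro h K _ _ hK p hp h3 hcpt π hL hreg
    exact h K p hcpt π ⟨hK, hp, h3, hL, hreg⟩

/-! ## §1  STRENGTHEN — candidate `S⁺` statements -/

/-- **S⁺₁ (cofinite-split form)**: for `π` in the sector, ALL BUT FINITELY MANY primes `ℓ₀` that
split completely in `K` carry an ordinary avatar for some `ι₀`.  Typed to record that it is FALSE:
for `π = AI_{L/K}(χ)` automorphically induced from a cyclic extension of degree `p` (in the sector: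
cuspidal, regular if `χ` is), every `v` of `K` inert in `L` has `p` EQUAL slopes, hence no `ι₀` is
ordinary at any totally split `ℓ₀` having an `L`-inert place above it — a set of primes of
positive density (census §Strengthen).  So no "for all large primes" rigidity is available even
conjecturally; only density statements are. [folklore] -/
def SPlusCofiniteSplit : Prop :=
  ∀ (K : Type) [Field K] [NumberField K] (p : ℕ) (hcpt : isCompact_glFiniteIntegralLevel p K)
    (π : CuspidalAutomorphicRepData p K hcpt), InSector K p π →
      ∀ᶠ ℓ₀ : ℕ in cofinite, ∀ [Fact ℓ₀.Prime], SplitsCompletely K ℓ₀ →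
        ∃ ι₀ : PadicAlgCl ℓ₀ ≃+* ℂ, HasOrdinaryAvatarAt π ℓ₀ ι₀

/-- **S⁺₂ (positive lower density = Serre's ordinariness conjecture for these `π`)**: the set of
ordinary primes of `π` has positive lower natural density (`WeierstrassCurve.primeCountingRatio`,
the tree's prime-counting ratio).  Expected (density one for Lie-irreducible `π`, `1/p` for
cyclically induced ones); OPEN already for Hilbert modular forms (Calegari arXiv:2109.14145 §9.6
p. 19) and for elliptic newforms of weight `k ≥ 4` over `ℚ`; known for weight `{0,1}`-type
objects (Serre 1981; Ogus; Pink 1998; Sawin 2016; Suh 2020; Fité 2024; Wang–Zhang 2026) and in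
weight `3` / Hodge–Tate `{0,1,2}` corners (Suh 2020 Prop. 36(2)).  The added rigidity (a density)
is exactly what the only known technique produces, but that technique does not run in rank
`p ≥ 3` outside the consecutive-weight corner (§2), so S⁺₂ buys nothing for THIS step.
[cite: arXiv:2410.01182, Conj. 1.1 and Prop. 36] -/
def SPlusLowerDensity : Prop :=
  ∀ (K : Type) [Field K] [NumberField K] (p : ℕ) (hcpt : isCompact_glFiniteIntegralLevel p K)
    (π : CuspidalAutomorphicRepData p K hcpt), InSector K p π →
      ∃ δ : ℝ, 0 < δ ∧ ∀ᶠ x : ℕ in atTop,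
        δ ≤ WeierstrassCurve.primeCountingRatio
          {ℓ₀ : ℕ | ∃ (_ : Fact ℓ₀.Prime) (ι₀ : PadicAlgCl ℓ₀ ≃+* ℂ), HasOrdinaryAvatarAt π ℓ₀ ι₀} x

/-- **Trivial glue**: S⁺₁ implies the crux, given that every number field has infinitely many
totally split primes (Chebotarev; kept as a hypothesis, the tree has no such lemma for
`SplitsCompletely`).  Recorded only to show S⁺₁ is a genuine strengthening. [folklore] -/
theorem ordinaryPrimeExists_of_sPlusCofiniteSplit
    (hinf : ∀ (K : Type) [Field K] [NumberField K], {ℓ : ℕ | ℓ.Prime ∧ SplitsCompletely K ℓ}.Infinite)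
    (h : SPlusCofiniteSplit) : OrdinaryPrimeExists := by
  rw [ordinaryPrimeExists_iff]
  intro K _ _ p hcpt π hπ
  have hev := h K p hcpt π hπ
  rw [Filter.eventually_cofinite] at hev
  obtain ⟨ℓ₀, ⟨hℓp, hsplit⟩, hgood⟩ := ((hinf K).sdiff hev).nonempty
  haveI : Fact ℓ₀.Prime := ⟨hℓp⟩
  have hgood' : ∀ [Fact ℓ₀.Prime], SplitsCompletely K ℓ₀ →
      ∃ ι₀ : PadicAlgCl ℓ₀ ≃+* ℂ, HasOrdinaryAvatarAt π ℓ₀ ι₀ := by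
    by_contra hc
    exact hgood hc
  obtain ⟨ι₀, hι⟩ := hgood' hsplit
  exact ⟨ℓ₀, ‹Fact ℓ₀.Prime›, ι₀, hι⟩

/-! ## §2  TRANSFER — the archimedean pinning lemma and its numerology

The solved sibling of EXACTLY this step is "an elliptic curve / weight-2 newform over `ℚ` has an
ordinary prime" (tree: `WeierstrassCurve.infinite_goodOrdinaryPrimes_holds`, PROVED; Serre 1981
§8).  Every proof of every solved sibling (Serre; Katz–Ogus for abelian surfaces; Pink 1998 for
`End = ℤ`; Suh 2020; Fité 2024; Wang–Zhang 2026) has the same two steps: (P) PINNING — if `π` is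
non-ordinary at `ℓ` for every `λ ∣ ℓ`, then a normalised Hecke eigenvalue `c_k(ℓ)` is divisible by
`ℓ^m` in the Hecke ring AND archimedeanly bounded by `B · ℓ^m` with `B` INDEPENDENT of `ℓ`
(Ramanujan / Hasse–Weil), so `c_k(ℓ) ∈ ℓ^m · S_B` for the FINITE set `S_B` of algebraic integers of
house `≤ B` (`pinning`, `pinningSet_finite`); (C) CHEBOTAREV — `c_k(ℓ) = u · ℓ^m` (`u ∈ S_B`) is an
algebraic condition `tr ∧^k ρ_{λ'}(Frob_ℓ) = u · ε(Frob_ℓ)^{-m}` on the Frobenius in a fixed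
`λ'`-adic image, a Haar-null set by Hodge–Tate regularity, hence density zero (Serre).  Step (C)
transfers verbatim to rank `p`; step (P) does NOT: with Hodge–Tate weights `0,1,…,n-1` and
Ramanujan, `|c_k(ℓ)| ≤ C(n,k) ℓ^{k(n-1)/2}` while non-ordinarity at the `k`-th break gives
`ℓ^{k(k-1)/2 + 1} ∣ c_k(ℓ)` (unique `λ ∣ ℓ`), and `k(n-1)/2 ≤ k(k-1)/2 + 1 ⇔ k(n-k) ≤ 2`, which holds
for all breaks `0 < k < n` iff `n ≤ 3` (`numerology_pass_two_three`, `numerology_fail`); with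
non-consecutive weights or several `λ ∣ ℓ` it fails already for `n = 3`.  This is Suh's
"obstruction of geometry-of-numbers type (Minkowski) just beyond the half-way threshold"
(arXiv:2410.01182, p. 2 of the introduction). -/

/-- **Pinning lemma (step (P) of every solved sibling).**  If `c = ℓ · u` in a number field `E` and
every complex conjugate of `c` has absolute value `≤ B · ℓ`, then every conjugate of `u` has
absolute value `≤ B` — so `u` ranges over the finite set `pinningSet_finite E B` once `u` is an
algebraic integer.  The content of the census is that the HYPOTHESIS `‖φ c‖ ≤ B · ℓ` with `B`
independent of `ℓ` is available only in the corner described above. [folklore] -/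
theorem pinning {E : Type} [Field E] [NumberField E] (ℓ : ℕ) (hℓ : 0 < ℓ) (B : ℝ) {c u : E}
    (hcu : c = (ℓ : E) * u) (hc : ∀ φ : E →+* ℂ, ‖φ c‖ ≤ B * ℓ) : ∀ φ : E →+* ℂ, ‖φ u‖ ≤ B := by
  intro φ
  have h := hc φ
  rw [hcu, map_mul, map_natCast, norm_mul, Complex.norm_natCast] at h
  have hℓ' : (0 : ℝ) < ℓ := by exact_mod_cast hℓ
  have h2 : ‖φ u‖ * (ℓ : ℝ) ≤ B * ℓ := by rw [mul_comm]; exact h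
  exact le_of_mul_le_mul_right h2 hℓ'

/-- **The pinning set is finite** (Mathlib `NumberField.Embeddings.finite_of_norm_le`): algebraic
integers of `E` all of whose conjugates have absolute value `≤ B`. [folklore] -/
theorem pinningSet_finite (E : Type) [Field E] [NumberField E] (B : ℝ) :
    {u : E | IsIntegral ℤ u ∧ ∀ φ : E →+* ℂ, ‖φ u‖ ≤ B}.Finite :=
  NumberField.Embeddings.finite_of_norm_le E ℂ B

/-- **Numerology, passing cases**: in rank `n ∈ {2, 3}` with consecutive weights every break
`0 < k < n` satisfies the (doubled) pinning inequality `k(n-1) ≤ k(k-1) + 2`. [folklore] -/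
theorem numerology_pass_two_three :
    ∀ n ∈ Finset.Icc 2 3, ∀ k ∈ Finset.Icc 1 (n - 1), k * (n - 1) ≤ k * (k - 1) + 2 := by
  decide

/-- **Numerology, failing cases**: from rank `n = 4` on (and, by the same count, in rank `3` with a
weight gap or with two primes `λ ∣ ℓ`) the first break already violates the pinning inequality, so
step (P) pins nothing: `c_1(ℓ)/ℓ` has house `≤ n · ℓ^{(n-3)/2}`, unbounded in `ℓ`. [folklore] -/
theorem numerology_fail (n : ℕ) (hn : 4 ≤ n) :
    ∃ k, 1 ≤ k ∧ k < n ∧ k * (k - 1) + 2 < k * (n - 1) :=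
  ⟨1, le_rfl, by omega, by omega⟩

/-- **The corner where the transfer DOES go through** (recorded for completeness; a paper-level
theorem, NOT a line for the crux, which is universal): `π` cuspidal on `GL_3(𝔸_ℚ)`, L-algebraic,
with CONSECUTIVE Hodge–Tate weights `{h, h-1, h-2}`, tempered at almost all `p` (Ramanujan — known
only when `π` is an essentially self-dual lift, open otherwise), whose Hecke eigenvalues lie in a
number field `E ⊂ ℂ` of degree `1` or a prime (so that a positive density of `ℓ` are INERT in `E`:
then "non-ordinary at every `λ ∣ ℓ`" is "non-ordinary at the unique `λ`", no mixing of breaks) —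
has an ordinary prime (indeed a set of positive lower density of them).  Proof on paper: at an
inert unramified `ℓ` with `π_ℓ` unramified, non-ordinarity forces `ℓ^{h-1} ∣ c_1(ℓ)` or
`ℓ^{2h-2} ∣ c_2(ℓ)` (Newton above Hodge, integral break points), Ramanujan gives
`|c_1| ≤ 3ℓ^{h-1}`, `|c_2| ≤ 3ℓ^{2h-2}`, so `pinning` applies with `B = 3`; then Chebotarev in the
image of `r_{π,λ'} ⊕ ε` (HLTT avatar; Hodge–Tate weights by AHTW 2026 after a CM quadratic base
change): on each coset of the identity component `t ↦ tr(g t)` (resp. `tr ∧²(g t)`) is non-constant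
on `(G°)^{der} ∈ {SL_3, SO_3, SL_2 × 1}` (its linear span is the full matrix algebra), and the
toric / abelian-summand cosets where it could be constant are excluded because a cuspidal `π`
whose avatar is a sum of automorphic abelian pieces would be an isobaric sum (Jacquet–Shalika).
Nearest print: Suh 2020 Prop. 36(2) (Hilbert weight `(3,…,3)`, same pinning with `B = 2`),
Wang–Zhang 2026 Thm 1.6–1.8 (weight `2`, the same degree-`1`-or-prime Hecke field device).
[cite: arXiv:2410.01182, Prop. 36] [cite: doi:10.1112/mtk.70081, Thm. 1.6–1.8] -/
def CornerGL3Q : Prop :=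
  ∀ (hcpt : isCompact_glFiniteIntegralLevel 3 ℚ) (π : CuspidalAutomorphicRepData 3 ℚ hcpt),
    π.1.IsLAlgebraic →
    (∃ (T : InfinityType ℚ 3) (h : ℤ), π.1.HasInfinityType T ∧
        ∀ σ : ℚ →+* ℂ, T.hodgeTateWeights σ =
          {((h : ℤ) : ℂ), (((h - 1 : ℤ)) : ℂ), (((h - 2 : ℤ)) : ℂ)}) →
    (∃ w : ℝ, ∀ᶠ v : HeightOneSpectrum (𝓞 ℚ) in cofinite, ∀ α : Multiset ℂ,
        π.1.HasSatakeParamAt v α → ∀ a ∈ α, ‖a‖ = (v.residueCard : ℝ) ^ w) →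
    (∃ E : IntermediateField ℚ ℂ, FiniteDimensional ℚ E ∧
        (Module.finrank ℚ E = 1 ∨ (Module.finrank ℚ E).Prime) ∧
        ∀ᶠ v : HeightOneSpectrum (𝓞 ℚ) in cofinite, ∀ α : Multiset ℂ, π.1.HasSatakeParamAt v α →
          ∀ i ≤ 3, ((((Real.sqrt (v.residueCard : ℝ)) : ℝ) : ℂ) ^ (i * (3 - i)) * α.esymm i) ∈ E) →
    ∃ (ℓ₀ : ℕ) (_ : Fact ℓ₀.Prime) (ι₀ : PadicAlgCl ℓ₀ ≃+* ℂ), HasOrdinaryAvatarAt π ℓ₀ ι₀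

/-! ## §3  NEGATION — the classical open problem the crux contains -/

/-- **Serre's ordinariness problem for `GL_2` over `ℚ`** in the crux's own vocabulary: every
cuspidal L-algebraic `π` on `GL_2(𝔸_ℚ)` with a regular infinity type (= a newform `f` of weight
`k ≥ 2` up to twist) has SOME prime `ℓ₀` and `ι₀` (= some `λ ∣ ℓ₀` of the Hecke field) with an
ordinary avatar, i.e. `λ ∤ a_{ℓ₀}(f)` (Hida's `λ`-ordinarity at one prime).  Known in weight `2`
(Serre 1981, density one) and weight `3` (pinning with `B = 2`, Suh 2020 Prop. 36); for a FIXED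
`f` of weight `k ≥ 4` an ordinary prime is found by computation (e.g. `Δ` at `11`), but NO theorem
produces one uniformly in `f` — heuristically (Gouvêa 1997) a form with Hecke field `ℚ` even has
infinitely many NON-ordinary primes.  The `K = ℚ`, `p = 3` slice of the crux implies this
statement for non-CM `f` through `Sym² f` (Gelbart–Jacquet: cuspidal on `GL_3`, regular with
weights `{0, k-1, 2k-2}`, L-algebraic; and `Sym² V` is Greenberg-ordinary at `ℓ` iff `V` is, since a
non-ordinary crystalline `V` is `Ind(χ)` up to twist and then `Sym² V = Ind(χ²) ⊕ (line)` has no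
stable full flag) — census §Negation.  Typed here so that refuters can probe it; deliberately NOT
filed as an item (it is not a route statement). [cite: arXiv:2410.01182, Conj. 1.1] -/
def SerreOrdinarinessGL2Q : Prop :=
  ∀ (hcpt : isCompact_glFiniteIntegralLevel 2 ℚ) (π : CuspidalAutomorphicRepData 2 ℚ hcpt),
    π.1.IsLAlgebraic → (∃ T : InfinityType ℚ 2, π.1.HasInfinityType T ∧ T.IsRegular) →
      ∃ (ℓ₀ : ℕ) (_ : Fact ℓ₀.Prime) (ι₀ : PadicAlgCl ℓ₀ ≃+* ℂ), HasOrdinaryAvatarAt π ℓ₀ ι₀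

end Summit.Langlands.Langlands.Cruxes.OrdinaryPrimeExists.Strategist

end
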